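import Summits.NavierStokesRegularity.NavierStokesRegularity.Theorems.CoriolisHeadLocalEnergyPhysicalSlices
import HarnessLib

/-!
# CoriolisHeadLocalEnergyLinearDensity — crux `NoCoRotatingCore` (stmt-NavierStokesRegularity-22676), line
# `local_energy_rescue` v2.1 (crux workfile, ns-idea-10 g3; unregistered), stub S3a `stub_localEnergyClass` —
# file 3: ONE physical local-energy round with the dissipation kept — linear density and the enstrophy bound

Let `U` be a bounded general-frame profile (`‖U‖ ≤ M`) whose physical rotated self-similar field `u` (`hu` of stubs
S3a/S3b) is a classical solution with pressure `p(t) = λ²P(λe^{−θB}·)` on `(−∞, 0)` (file 1), and suppose a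
SUB-VOLUME density `∫_{B(z,ρ)}‖U‖² ≤ Aρ^γ` and a gauged pressure-flux bound `∫_{B(z,ρ)}|P − m|‖U‖ ≤ J₀ρ^γ` hold for
ALL `ρ > 0` with some `0 ≤ γ < 2`.  The physical local energy identity WITH its dissipation term
(`IsClassicalNSSolutionOn.local_energy_identity_cutoff`) against a translated time-independent bump `φ₀(· − x₀)`
on `[−1, t₁]`, `t₁ < 0`, read slice by slice in similarity variables (file 2), has a right-hand side bounded
UNIFORMLY in `t₁` and `x₀`: every flux term is `≲ λ(s)^γ = (2a(−s))^{−γ/2}`, integrable up to `s = 0` because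
`γ < 2` (`integral_rpow_neg_le`).  Hence (`energy_round`)
`∫ φ|u(t₁)|² + 2ν ∫_{−1}^{t₁}∫ |∇u|²φ ≤ C` for all `t₁ ∈ [−1, 0)` and all centres `x₀`, which gives at once

* `linearDensity_of_subVolume` — **S3a (i)**: `∫_{B(z,ρ)}‖U‖² ≤ K₃ ρ` for all `ρ ≥ 1` (the bottom of the identity is
  `λ⁻¹∫_{B(z,λ)}‖U‖²`, every centre `z` and every scale `λ ≥ (2a)^{−1/2}` being reached by a choice of `(x₀, t₁)`);
* `dissipation_bound` — `2ν ∫_{−1}^{t₁}∫ |∇u|² φ₀ ≤ C` for a bump `φ₀ = 1` on `B(0,1)`, all `t₁ ∈ [−1,0)` (the enstrophy half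
  of the CKN class `hgrad` of S3a (ii); no almost-monotonicity identity is needed in the physical picture).

HONEST FRAMING.  Helper for an unregistered line's stub (S3a); nothing here proves `NoCoRotatingCore` or NS regularity.

References: L. Caffarelli, R. Kohn, L. Nirenberg, CPAM 35 (1982) §2 (2.5) [CaffarelliKohnNirenberg1982]; T.-P. Tsai,
ARMA 143 (1998) Lemma 4.1 [Tsai1998]; D. Chae, J. Wolf, arXiv:1610.09464, §2 Step 2 [ChaeWolf2017RemovingDSS]; line card
`Lines/local_energy_rescue.md` (S3a).
-/

noncomputable section

open MeasureTheory Set Function Filter Topology Metric InnerProductSpace Real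
open scoped RealInnerProductSpace Laplacian ContDiff Topology

-- the summit and its single sub-problem share the name (CONVENTIONS §1), as in every Theorems file
set_option linter.dupNamespace false
-- nested operator types `ℝ³ →L[ℝ] ℝ³` inside the Banach algebra `ℝ³ →L[ℝ] ℝ³` (as in `CoriolisHeadTypeIRateTransport`)
set_option maxSynthPendingDepth 3

namespace Summit.NavierStokesRegularity.NavierStokesRegularity.Theorems.CoriolisHead

namespace LocalEnergyRescue

open Literature.Analysis.FluidPDE

/-! ## §1 Real-exponent time integrals -/

/-- `∫_{−1}^{t₁} (−s)^{−q} ds ≤ 1/(1 − q)` for `q < 1`, `t₁ ∈ [−1, 0)` (antiderivative `−(−s)^{1−q}/(1−q)`). [folklore] -/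
theorem integral_rpow_neg_le {q : ℝ} (hq : q < 1) {t₁ : ℝ} (ht₁ : -1 ≤ t₁) (ht₁0 : t₁ < 0) :
    ∫ s in (-1 : ℝ)..t₁, (-s) ^ (-q) ≤ 1 / (1 - q) := by
  have h1q : 0 < 1 - q := by linarith
  have hderiv : ∀ s ∈ uIcc (-1 : ℝ) t₁,
      HasDerivAt (fun s : ℝ => -(-s) ^ (1 - q) / (1 - q)) ((-s) ^ (-q)) s := by
    intro s hs
    rw [uIcc_of_le ht₁] at hs
    have hs0 : 0 < -s := by linarith [lt_of_le_of_lt hs.2 ht₁0]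
    have h := ((Real.hasDerivAt_rpow_const (p := 1 - q) (Or.inl hs0.ne')).comp s (hasDerivAt_neg s)).neg.div_const
      (1 - q)
    refine h.congr_deriv ?_
    rw [show (1 - q - 1 : ℝ) = -q by ring]
    field_simp
  have hcont : ContinuousOn (fun s : ℝ => (-s) ^ (-q)) (uIcc (-1 : ℝ) t₁) := by
    rw [uIcc_of_le ht₁]
    refine ContinuousOn.rpow_const (continuous_neg.continuousOn) fun s hs => Or.inl ?_
    have : 0 < -s := by linarith [lt_of_le_of_lt hs.2 ht₁0]
    exact this.ne'
  rw [intervalIntegral.integral_eq_sub_of_hasDerivAt hderiv (hcont.intervalIntegrable)]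
  simp only [neg_neg, Real.one_rpow]
  have hpos : 0 ≤ (-t₁) ^ (1 - q) := Real.rpow_nonneg (by linarith) _
  have e : -(-t₁) ^ (1 - q) / (1 - q) - -(1 : ℝ) / (1 - q) = (1 - (-t₁) ^ (1 - q)) / (1 - q) := by ring
  rw [e]
  exact div_le_div_of_nonneg_right (by linarith) h1q.le

/-- The scale as a real power: `λ(s)^γ = (2a)^{−γ/2} (−s)^{−γ/2}` for `s < 0`. [folklore] -/
theorem scale_rpow {a : ℝ} (ha : 0 < a) {s : ℝ} (hs : s < 0) (γ : ℝ) :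
    (Real.sqrt (2 * a * (0 - s)))⁻¹ ^ γ = (2 * a) ^ (-(γ / 2)) * (-s) ^ (-(γ / 2)) := by
  have h2a : 0 ≤ 2 * a := by positivity
  have hs' : 0 ≤ -s := by linarith
  rw [zero_sub, Real.sqrt_eq_rpow, Real.inv_rpow (Real.rpow_nonneg (mul_nonneg h2a hs') _),
    ← Real.rpow_mul (mul_nonneg h2a hs'), Real.mul_rpow h2a hs', mul_inv, ← Real.rpow_neg h2a, ← Real.rpow_neg hs',
    show -(1 / 2 * γ) = -(γ / 2) by ring]

/-- The inverse scale is at most `√(2a)` on `[−1, 0)`: `λ(s)⁻¹ = √(2a(−s)) ≤ √(2a)`. [folklore] -/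
theorem inv_scale_le {a : ℝ} (ha : 0 < a) {s : ℝ} (hs1 : -1 ≤ s) :
    ((Real.sqrt (2 * a * (0 - s)))⁻¹)⁻¹ ≤ Real.sqrt (2 * a) := by
  rw [inv_inv]
  exact Real.sqrt_le_sqrt (by nlinarith)

/-! ## §2 The energy round with the dissipation kept -/

section Round

variable {ν a : ℝ} {B : EuclideanSpace ℝ (Fin 3) →L[ℝ] EuclideanSpace ℝ (Fin 3)}
  {U : EuclideanSpace ℝ (Fin 3) → EuclideanSpace ℝ (Fin 3)} {P : EuclideanSpace ℝ (Fin 3) → ℝ}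
  {u : ℝ → EuclideanSpace ℝ (Fin 3) → EuclideanSpace ℝ (Fin 3)} {p : ℝ → EuclideanSpace ℝ (Fin 3) → ℝ}

/-- **The physical local energy round with the dissipation kept.**  Let `u` be the physical field of a bounded
profile `U` (`‖U‖ ≤ M`), `(u, p)` a classical solution on `(−∞, 0)` (viscosity `ν ≥ 0`) with `p(t) = λ²P(λe^{−θB}·)`,
and assume for ALL radii `ρ > 0` a density bound `∫_{B(z,ρ)}‖U‖² ≤ Aρ^γ` and a gauged pressure-flux bound
`∫_{B(z,ρ)}|P − m|‖U‖ ≤ J₀ρ^γ`, `γ < 2`.  Let `φ ∈ C_c^∞`, `|φ|, ‖Dφ‖, |Δφ| ≤ B₀`, vanishing with its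
derivatives off `B(x₀, R)`, `R ≥ 1`.  Then for every `t₁ ∈ [−1, 0)`:
`∫ φ‖u(t₁)‖² + 2ν ∫_{−1}^{t₁} ∫ |∇u(s)|²_F φ ≤ B₀ R^γ (2a)^{(1−γ)/2} A + (2/(2−γ)) (2a)^{−γ/2} R^γ B₀ (ν√(2a)A + MA + 2J₀)` —
the local energy identity `local_energy_identity_cutoff`, the top read at `t = −1` (`integral_cutoff_physicalField_le`),
the flux slice by slice (`flux_physicalField_le`) and `∫_{−1}^{t₁} (−s)^{−γ/2} ds ≤ 2/(2 − γ)`.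
[cite: CaffarelliKohnNirenberg1982, §2 (2.5); ChaeWolf2017RemovingDSS, §2 Step 2 (arXiv p. 5)] -/
theorem energy_round (hν : 0 ≤ ν) (ha : 0 < a) (hB : ∀ x, inner ℝ (B x) x = 0)
    (hu : ∀ (t : ℝ) (x : EuclideanSpace ℝ (Fin 3)), u t x =
      (Real.sqrt (2 * a * (0 - t)))⁻¹ • (NormedSpace.exp ((a⁻¹ * Real.log (Real.sqrt (2 * a * (0 - t)))⁻¹) • B))
        (U ((Real.sqrt (2 * a * (0 - t)))⁻¹ •
          (NormedSpace.exp ((-(a⁻¹ * Real.log (Real.sqrt (2 * a * (0 - t)))⁻¹)) • B)) x)))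
    (hNS : IsClassicalNSSolutionOn (Iio 0) ν 0 u p)
    (hp : ∀ t : ℝ, t < 0 → ∀ x : EuclideanSpace ℝ (Fin 3), p t x = (Real.sqrt (2 * a * (0 - t)))⁻¹ ^ 2 *
      P ((Real.sqrt (2 * a * (0 - t)))⁻¹ •
        (NormedSpace.exp ((-(a⁻¹ * Real.log (Real.sqrt (2 * a * (0 - t)))⁻¹)) • B)) x))
    (hUc : Continuous U) {M : ℝ} (hM : ∀ y, ‖U y‖ ≤ M) {A J₀ γ : ℝ} (hγ2 : γ < 2)
    (hI : ∀ (z : EuclideanSpace ℝ (Fin 3)) (ρ : ℝ), 0 < ρ → ∫ y in ball z ρ, ‖U y‖ ^ 2 ≤ A * ρ ^ γ)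
    (hJ : ∀ (z : EuclideanSpace ℝ (Fin 3)) (ρ : ℝ), 0 < ρ →
      ∃ m : ℝ, ∫ y in ball z ρ, |P y - m| * ‖U y‖ ≤ J₀ * ρ ^ γ)
    {φ : EuclideanSpace ℝ (Fin 3) → ℝ} (hφ : ContDiff ℝ ∞ φ) (hφc : HasCompactSupport φ)
    {x₀ : EuclideanSpace ℝ (Fin 3)} {R B₀ : ℝ} (hR : 1 ≤ R)
    (hφB : ∀ x, |φ x| ≤ B₀) (hDφ : ∀ x, ‖fderiv ℝ φ x‖ ≤ B₀) (hΔφ : ∀ x, |(Δ φ) x| ≤ B₀)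
    (hφR : ∀ x, x ∉ ball x₀ R → φ x = 0) (hD0 : ∀ x, x ∉ ball x₀ R → fderiv ℝ φ x = 0)
    (hΔ0 : ∀ x, x ∉ ball x₀ R → (Δ φ) x = 0)
    {t₁ : ℝ} (ht₁ : -1 ≤ t₁) (ht₁0 : t₁ < 0) :
    (∫ x, φ x * ‖u t₁ x‖ ^ 2) + 2 * ν * ∫ s in (-1 : ℝ)..t₁, ∫ x, frobeniusNormSq (fderiv ℝ (u s) x) * φ x ≤
      B₀ * (Real.sqrt (2 * a) * (A * (R * (Real.sqrt (2 * a))⁻¹) ^ γ)) +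
        2 / (2 - γ) * ((2 * a) ^ (-(γ / 2)) * R ^ γ * B₀ * (ν * Real.sqrt (2 * a) * A + M * A + 2 * J₀)) := by
  have hB0 : 0 ≤ B₀ := (abs_nonneg _).trans (hφB x₀)
  have hM0 : 0 ≤ M := (norm_nonneg _).trans (hM 0)
  have h2a : 0 < 2 * a := by positivity
  have hR0 : 0 < R := by linarith
  have hA0 : 0 ≤ A := by
    have h := hI 0 1 one_pos
    have h0 : 0 ≤ ∫ y in ball (0 : EuclideanSpace ℝ (Fin 3)) 1, ‖U y‖ ^ 2 :=
      setIntegral_nonneg measurableSet_ball fun y _ => by positivity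
    rw [Real.one_rpow, mul_one] at h
    linarith
  have hJ0 : 0 ≤ J₀ := by
    obtain ⟨m, hm⟩ := hJ 0 1 one_pos
    have h0 : 0 ≤ ∫ y in ball (0 : EuclideanSpace ℝ (Fin 3)) 1, |P y - m| * ‖U y‖ :=
      setIntegral_nonneg measurableSet_ball fun y _ => by positivity
    rw [Real.one_rpow, mul_one] at hm
    linarith
  -- the identity on `[-1, t₁]`
  have hIcc : Icc (-1 : ℝ) t₁ ⊆ Iio 0 := fun s hs => lt_of_le_of_lt hs.2 ht₁0
  have hid := hNS.local_energy_identity_cutoff isOpen_Iio hφ hφc ht₁ hIcc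
  -- the top, at `t = -1`
  have hm1 : (-1 : ℝ) < 0 := by norm_num
  have htop := integral_cutoff_physicalField_le ha hB hu hNS hφ.continuous hφc hφB hφR hm1
  have hlam1 : (Real.sqrt (2 * a * (0 - (-1 : ℝ))))⁻¹ = (Real.sqrt (2 * a))⁻¹ := by norm_num
  rw [hlam1, inv_inv] at htop
  have hc0 : 0 < (Real.sqrt (2 * a))⁻¹ := inv_pos.2 (Real.sqrt_pos.2 h2a)
  have htop' : ∫ x, φ x * ‖u (-1) x‖ ^ 2 ≤ B₀ * (Real.sqrt (2 * a) * (A * (R * (Real.sqrt (2 * a))⁻¹) ^ γ)) :=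
    htop.trans (mul_le_mul_of_nonneg_left (mul_le_mul_of_nonneg_left (hI _ _ (by positivity))
      (Real.sqrt_nonneg _)) hB0)
  -- the flux, slice by slice
  set Kg : ℝ := (2 * a) ^ (-(γ / 2)) * R ^ γ * B₀ * (ν * Real.sqrt (2 * a) * A + M * A + 2 * J₀) with hKg
  have hKg0 : 0 ≤ Kg := by positivity
  have hflux : ∀ s ∈ Icc (-1 : ℝ) t₁,
      (∫ x, (ν * ((Δ φ) x * ‖u s x‖ ^ 2) + fderiv ℝ φ x (u s x) * ‖u s x‖ ^ 2 +
        2 * (p s x * fderiv ℝ φ x (u s x)))) ≤ Kg * (-s) ^ (-(γ / 2)) := by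
    intro s hs
    have hs0 : s < 0 := hIcc hs
    set lam : ℝ := (Real.sqrt (2 * a * (0 - s)))⁻¹ with hlam
    have hlam0 : 0 < lam := scale_pos ha hs0
    set zs : EuclideanSpace ℝ (Fin 3) := lam • NormedSpace.exp ((-(a⁻¹ * Real.log lam)) • B) x₀ with hzs
    set ρs : ℝ := R * lam with hρs
    have hρs0 : 0 < ρs := by positivity
    obtain ⟨m, hm⟩ := hJ zs ρs hρs0
    have h := flux_physicalField_le hν ha hB hu hNS hφ hφc hDφ hΔφ hD0 hΔ0 hs0 (hp s hs0) m
    rw [← hlam, ← hzs, ← hρs] at h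
    -- the three profile integrals
    have hI2 : ∫ y in ball zs ρs, ‖U y‖ ^ 2 ≤ A * ρs ^ γ := hI zs ρs hρs0
    have hI3 : ∫ y in ball zs ρs, ‖U y‖ ^ 3 ≤ M * (A * ρs ^ γ) := by
      have hV3 : IntegrableOn (fun y => ‖U y‖ ^ 3) (ball zs ρs) volume :=
        ((hUc.norm.pow 3).continuousOn.integrableOn_compact (isCompact_closedBall zs ρs)).mono_set
          ball_subset_closedBall
      have hV2 : IntegrableOn (fun y => M * ‖U y‖ ^ 2) (ball zs ρs) volume :=
        (((hUc.norm.pow 2).continuousOn.integrableOn_compact (isCompact_closedBall zs ρs)).mono_set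
          ball_subset_closedBall).const_mul M
      calc ∫ y in ball zs ρs, ‖U y‖ ^ 3 ≤ ∫ y in ball zs ρs, M * ‖U y‖ ^ 2 := by
            refine setIntegral_mono_on hV3 hV2 measurableSet_ball fun y _ => ?_
            have e : ‖U y‖ ^ 3 = ‖U y‖ * ‖U y‖ ^ 2 := by ring
            rw [e]
            exact mul_le_mul_of_nonneg_right (hM y) (by positivity)
        _ = M * ∫ y in ball zs ρs, ‖U y‖ ^ 2 := integral_const_mul _ _
        _ ≤ M * (A * ρs ^ γ) := mul_le_mul_of_nonneg_left hI2 hM0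
    have hργ : ρs ^ γ = R ^ γ * ((2 * a) ^ (-(γ / 2)) * (-s) ^ (-(γ / 2))) := by
      rw [hρs, Real.mul_rpow hR0.le hlam0.le, hlam, scale_rpow ha hs0]
    have hsγ0 : 0 ≤ (-s) ^ (-(γ / 2)) := Real.rpow_nonneg (by linarith) _
    have hinv : lam⁻¹ ≤ Real.sqrt (2 * a) := inv_scale_le ha hs.1
    refine h.trans ?_
    have t1 : B₀ * (ν * (lam⁻¹ * ∫ y in ball zs ρs, ‖U y‖ ^ 2)) ≤ B₀ * (ν * (Real.sqrt (2 * a) * (A * ρs ^ γ))) := by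
      have h20 : 0 ≤ ∫ y in ball zs ρs, ‖U y‖ ^ 2 := setIntegral_nonneg measurableSet_ball fun y _ => by positivity
      exact mul_le_mul_of_nonneg_left (mul_le_mul_of_nonneg_left
        (mul_le_mul hinv hI2 h20 (Real.sqrt_nonneg _)) hν) hB0
    have t2 : B₀ * (∫ y in ball zs ρs, ‖U y‖ ^ 3) ≤ B₀ * (M * (A * ρs ^ γ)) := mul_le_mul_of_nonneg_left hI3 hB0
    have t3 : 2 * B₀ * (∫ y in ball zs ρs, |P y - m| * ‖U y‖) ≤ 2 * B₀ * (J₀ * ρs ^ γ) :=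
      mul_le_mul_of_nonneg_left hm (by positivity)
    have e : B₀ * (ν * (Real.sqrt (2 * a) * (A * ρs ^ γ))) + B₀ * (M * (A * ρs ^ γ)) + 2 * B₀ * (J₀ * ρs ^ γ) =
        Kg * (-s) ^ (-(γ / 2)) := by
      rw [hργ, hKg]; ring
    linarith [t1, t2, t3, e]
  -- integrate the flux bound in time
  have hcontF := hNS.continuousOn_integral_flux_cutoff hφ hφc
  have hFint : IntervalIntegrable (fun s => ∫ x, (ν * ((Δ φ) x * ‖u s x‖ ^ 2) +
        fderiv ℝ φ x (u s x) * ‖u s x‖ ^ 2 + 2 * (p s x * fderiv ℝ φ x (u s x)))) volume (-1) t₁ :=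
    (hcontF.mono (by rwa [uIcc_of_le ht₁])).intervalIntegrable
  have hgcont : ContinuousOn (fun s : ℝ => Kg * (-s) ^ (-(γ / 2))) (uIcc (-1) t₁) := by
    rw [uIcc_of_le ht₁]
    refine continuousOn_const.mul (ContinuousOn.rpow_const continuous_neg.continuousOn fun s hs => Or.inl ?_)
    have : 0 < -s := by linarith [lt_of_le_of_lt hs.2 ht₁0]
    exact this.ne'
  have hgint := hgcont.intervalIntegrable (μ := volume)
  have hmono := intervalIntegral.integral_mono_on ht₁ hFint hgint hflux
  have hgval : ∫ s in (-1 : ℝ)..t₁, Kg * (-s) ^ (-(γ / 2)) ≤ Kg * (2 / (2 - γ)) := by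
    rw [intervalIntegral.integral_const_mul]
    refine mul_le_mul_of_nonneg_left ?_ hKg0
    have h := integral_rpow_neg_le (q := γ / 2) (by linarith) ht₁ ht₁0
    have e : (1 : ℝ) / (1 - γ / 2) = 2 / (2 - γ) := by
      field_simp
    rwa [e] at h
  have e2 : Kg * (2 / (2 - γ)) = 2 / (2 - γ) * ((2 * a) ^ (-(γ / 2)) * R ^ γ * B₀ *
      (ν * Real.sqrt (2 * a) * A + M * A + 2 * J₀)) := by rw [hKg]; ring
  linarith [hid, htop', hmono, hgval, e2]

/-! ## §3 Linear density (S3a (i)) and the enstrophy bound -/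

/-- **Linear energy density from sub-volume density — S3a (i) of the line.**  Under the hypotheses of
`energy_round` (density `Aρ^γ` and gauged pressure flux `J₀ρ^γ` at ALL radii, `0 ≤ γ < 2`), the profile has LINEAR
energy density: `∫_{B(z,ρ)}‖U‖² ≤ K₃ ρ` for all `ρ ≥ 1` and all centres `z`.  Every centre `z` and every scale
`ρ ≥ (2a)^{−1/2}` is the bottom `λ⁻¹∫_{B(z,λ)}‖U‖²` of the identity for `t₁ = −(2aρ²)⁻¹`, `x₀ = ρ⁻¹e^{θB}z`; smaller radii
by the trivial bound `M²|B₁|ρ³`. [cite: Tsai1998, Lemma 4.1 (p. 46); CaffarelliKohnNirenberg1982 §2 (2.5)] -/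
theorem linearDensity_of_subVolume (hν : 0 ≤ ν) (ha : 0 < a) (hB : ∀ x, inner ℝ (B x) x = 0)
    (hu : ∀ (t : ℝ) (x : EuclideanSpace ℝ (Fin 3)), u t x =
      (Real.sqrt (2 * a * (0 - t)))⁻¹ • (NormedSpace.exp ((a⁻¹ * Real.log (Real.sqrt (2 * a * (0 - t)))⁻¹) • B))
        (U ((Real.sqrt (2 * a * (0 - t)))⁻¹ •
          (NormedSpace.exp ((-(a⁻¹ * Real.log (Real.sqrt (2 * a * (0 - t)))⁻¹)) • B)) x)))
    (hNS : IsClassicalNSSolutionOn (Iio 0) ν 0 u p)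
    (hp : ∀ t : ℝ, t < 0 → ∀ x : EuclideanSpace ℝ (Fin 3), p t x = (Real.sqrt (2 * a * (0 - t)))⁻¹ ^ 2 *
      P ((Real.sqrt (2 * a * (0 - t)))⁻¹ •
        (NormedSpace.exp ((-(a⁻¹ * Real.log (Real.sqrt (2 * a * (0 - t)))⁻¹)) • B)) x))
    (hUc : Continuous U) {M : ℝ} (hM : ∀ y, ‖U y‖ ≤ M) {A J₀ γ : ℝ} (hγ2 : γ < 2)
    (hI : ∀ (z : EuclideanSpace ℝ (Fin 3)) (ρ : ℝ), 0 < ρ → ∫ y in ball z ρ, ‖U y‖ ^ 2 ≤ A * ρ ^ γ)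
    (hJ : ∀ (z : EuclideanSpace ℝ (Fin 3)) (ρ : ℝ), 0 < ρ →
      ∃ m : ℝ, ∫ y in ball z ρ, |P y - m| * ‖U y‖ ≤ J₀ * ρ ^ γ) :
    ∃ K₃ : ℝ, 0 ≤ K₃ ∧ ∀ (z : EuclideanSpace ℝ (Fin 3)) (ρ : ℝ), 1 ≤ ρ → ∫ y in ball z ρ, ‖U y‖ ^ 2 ≤ K₃ * ρ := by
  obtain ⟨φ₀, R, B₀, hR1, hB0, hφ₀, hφ₀c, hφ₀nn, hφ₀one, hbd⟩ := exists_cutoff_data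
  have hM0 : 0 ≤ M := (norm_nonneg _).trans (hM 0)
  have h2a : 0 < 2 * a := by positivity
  have hA0 : 0 ≤ A := by
    have h := hI 0 1 one_pos
    have h0 : 0 ≤ ∫ y in ball (0 : EuclideanSpace ℝ (Fin 3)) 1, ‖U y‖ ^ 2 :=
      setIntegral_nonneg measurableSet_ball fun y _ => by positivity
    rw [Real.one_rpow, mul_one] at h
    linarith
  have hJ0 : 0 ≤ J₀ := by
    obtain ⟨m, hm⟩ := hJ 0 1 one_pos
    have h0 : 0 ≤ ∫ y in ball (0 : EuclideanSpace ℝ (Fin 3)) 1, |P y - m| * ‖U y‖ :=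
      setIntegral_nonneg measurableSet_ball fun y _ => by positivity
    rw [Real.one_rpow, mul_one] at hm
    linarith
  -- the uniform constant of the energy round
  set C : ℝ := B₀ * (Real.sqrt (2 * a) * (A * (R * (Real.sqrt (2 * a))⁻¹) ^ γ)) +
    2 / (2 - γ) * ((2 * a) ^ (-(γ / 2)) * R ^ γ * B₀ * (ν * Real.sqrt (2 * a) * A + M * A + 2 * J₀)) with hC
  have hC0 : 0 ≤ C := by
    have h1 : 0 ≤ (R * (Real.sqrt (2 * a))⁻¹) ^ γ := Real.rpow_nonneg (by positivity) _
    have h2 : 0 ≤ (2 * a) ^ (-(γ / 2)) := Real.rpow_nonneg h2a.le _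
    have h3 : 0 ≤ R ^ γ := Real.rpow_nonneg (by linarith) _
    have h4 : 0 < 2 / (2 - γ) := div_pos two_pos (by linarith)
    positivity
  set W : ℝ := (volume (ball (0 : EuclideanSpace ℝ (Fin 3)) 1)).toReal with hW
  refine ⟨C + M ^ 2 * W * (2 * a)⁻¹, by positivity, fun z ρ hρ => ?_⟩
  have hρ0 : 0 < ρ := by linarith
  rcases le_or_gt ((Real.sqrt (2 * a))⁻¹) ρ with hρc | hρc
  · -- the scale `ρ` is reached at `t₁ = -(2aρ²)⁻¹`
    set t₁ : ℝ := -(2 * a * ρ ^ 2)⁻¹ with ht₁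
    have ht₁0 : t₁ < 0 := by rw [ht₁]; exact neg_neg_of_pos (by positivity)
    have ht₁1 : -1 ≤ t₁ := by
      rw [ht₁, neg_le_neg_iff]
      have hsq : (Real.sqrt (2 * a))⁻¹ ^ 2 ≤ ρ ^ 2 := pow_le_pow_left₀ (by positivity) hρc 2
      rw [inv_pow, Real.sq_sqrt h2a.le] at hsq
      have h1 : 1 ≤ 2 * a * ρ ^ 2 := by
        have := mul_le_mul_of_nonneg_left hsq h2a.le
        rwa [mul_inv_cancel₀ h2a.ne'] at this
      exact inv_le_one_of_one_le₀ h1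
    have hlam : (Real.sqrt (2 * a * (0 - t₁)))⁻¹ = ρ := by
      have e : 2 * a * (0 - t₁) = (ρ⁻¹) ^ 2 := by
        rw [ht₁, zero_sub, neg_neg, inv_pow]
        field_simp
      rw [e, Real.sqrt_sq (by positivity), inv_inv]
    set θ : ℝ := a⁻¹ * Real.log ρ with hθ
    set x₀ : EuclideanSpace ℝ (Fin 3) := ρ⁻¹ • NormedSpace.exp (θ • B) z with hx₀
    have hz : ρ • NormedSpace.exp ((-θ) • B) x₀ = z := by
      rw [hx₀, map_smul, smul_smul, mul_inv_cancel₀ hρ0.ne', one_smul]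
      have h := TypeIRate.flow_flow_neg B z (-θ)
      rwa [neg_neg] at h
    -- the energy round for the translate `φ₀(· − x₀)`
    have hE := energy_round hν ha hB hu hNS hp hUc hM hγ2 hI hJ
      (φ := fun x => φ₀ (x - x₀)) ((isTestFunctionOn_comp_sub_right ⟨hφ₀, hφ₀c, by simp⟩ x₀).contDiff)
      ((isTestFunctionOn_comp_sub_right ⟨hφ₀, hφ₀c, by simp⟩ x₀).hasCompactSupport) hR1
      (fun x => (hbd x₀ x).1) (fun x => (hbd x₀ x).2.1) (fun x => (hbd x₀ x).2.2.1)
      (fun x hx => ((hbd x₀ x).2.2.2 hx).1) (fun x hx => ((hbd x₀ x).2.2.2 hx).2.1)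
      (fun x hx => ((hbd x₀ x).2.2.2 hx).2.2) ht₁1 ht₁0
    rw [← hC] at hE
    -- the dissipation is nonnegative
    have hdiss : 0 ≤ 2 * ν * ∫ s in (-1 : ℝ)..t₁, ∫ x, frobeniusNormSq (fderiv ℝ (u s) x) * φ₀ (x - x₀) := by
      refine mul_nonneg (by positivity) (intervalIntegral.integral_nonneg ht₁1 fun s _ => ?_)
      exact integral_nonneg fun x => mul_nonneg (frobeniusNormSq_nonneg _) (hφ₀nn _)
    -- the bottom
    have hφ1 : ∀ x ∈ ball x₀ 1, φ₀ (x - x₀) = 1 := fun x hx => by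
      refine hφ₀one _ ?_
      rwa [mem_ball_zero_iff, ← dist_eq_norm, ← mem_ball]
    have hbot := inv_mul_setIntegral_le_integral_cutoff_physicalField ha hB hu hNS
      (φ := fun x => φ₀ (x - x₀)) (hφ₀.continuous.comp (continuous_id.sub continuous_const))
      ((isTestFunctionOn_comp_sub_right ⟨hφ₀, hφ₀c, by simp⟩ x₀).hasCompactSupport) (fun x => hφ₀nn _) hφ1 ht₁0
    simp only [hlam, one_mul] at hbot
    rw [hz] at hbot
    have hkey : ρ⁻¹ * ∫ y in ball z ρ, ‖U y‖ ^ 2 ≤ C := by linarith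
    have h2 : ∫ y in ball z ρ, ‖U y‖ ^ 2 ≤ C * ρ := by
      have := mul_le_mul_of_nonneg_left hkey hρ0.le
      rwa [← mul_assoc, mul_inv_cancel₀ hρ0.ne', one_mul, mul_comm] at this
    have h3 : 0 ≤ M ^ 2 * W * (2 * a)⁻¹ * ρ := by positivity
    nlinarith [h2, h3]
  · -- small radii: the trivial bound
    have htriv : ∫ y in ball z ρ, ‖U y‖ ^ 2 ≤ M ^ 2 * W * ρ ^ 3 := by
      have h := setIntegral_ball_norm_sq_le_cube (V := U) hM z hρ0
      rwa [← hW] at h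
    have hρ2 : ρ ^ 2 ≤ (2 * a)⁻¹ := by
      have h := pow_le_pow_left₀ hρ0.le hρc.le 2
      rwa [inv_pow, Real.sq_sqrt h2a.le] at h
    have hρ3 : ρ ^ 3 ≤ (2 * a)⁻¹ * ρ := by nlinarith
    have h3 : 0 ≤ C * ρ := by positivity
    nlinarith [htriv, hρ3, h3, mul_le_mul_of_nonneg_left hρ3 (by positivity : (0 : ℝ) ≤ M ^ 2 * W)]

/-- **The enstrophy bound (the `hgrad` half of S3a (ii)).**  Under the hypotheses of `energy_round` with `ν > 0`,
there are a bump `φ ∈ C_c^∞`, `0 ≤ φ`, `φ = 1` on `B(0,1)`, and a constant `C` with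
`∫_{−1}^{t₁} ∫ |∇u(s)|²_F φ ≤ C` for every `t₁ ∈ [−1, 0)` — the dissipation term of the physical local energy identity.
[cite: CaffarelliKohnNirenberg1982, §2 (2.5)] -/
theorem dissipation_bound (hν : 0 < ν) (ha : 0 < a) (hB : ∀ x, inner ℝ (B x) x = 0)
    (hu : ∀ (t : ℝ) (x : EuclideanSpace ℝ (Fin 3)), u t x =
      (Real.sqrt (2 * a * (0 - t)))⁻¹ • (NormedSpace.exp ((a⁻¹ * Real.log (Real.sqrt (2 * a * (0 - t)))⁻¹) • B))
        (U ((Real.sqrt (2 * a * (0 - t)))⁻¹ •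
          (NormedSpace.exp ((-(a⁻¹ * Real.log (Real.sqrt (2 * a * (0 - t)))⁻¹)) • B)) x)))
    (hNS : IsClassicalNSSolutionOn (Iio 0) ν 0 u p)
    (hp : ∀ t : ℝ, t < 0 → ∀ x : EuclideanSpace ℝ (Fin 3), p t x = (Real.sqrt (2 * a * (0 - t)))⁻¹ ^ 2 *
      P ((Real.sqrt (2 * a * (0 - t)))⁻¹ •
        (NormedSpace.exp ((-(a⁻¹ * Real.log (Real.sqrt (2 * a * (0 - t)))⁻¹)) • B)) x))
    (hUc : Continuous U) {M : ℝ} (hM : ∀ y, ‖U y‖ ≤ M) {A J₀ γ : ℝ} (hγ2 : γ < 2)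
    (hI : ∀ (z : EuclideanSpace ℝ (Fin 3)) (ρ : ℝ), 0 < ρ → ∫ y in ball z ρ, ‖U y‖ ^ 2 ≤ A * ρ ^ γ)
    (hJ : ∀ (z : EuclideanSpace ℝ (Fin 3)) (ρ : ℝ), 0 < ρ →
      ∃ m : ℝ, ∫ y in ball z ρ, |P y - m| * ‖U y‖ ≤ J₀ * ρ ^ γ) :
    ∃ (C : ℝ) (φ : EuclideanSpace ℝ (Fin 3) → ℝ), ContDiff ℝ ∞ φ ∧ HasCompactSupport φ ∧ (∀ x, 0 ≤ φ x) ∧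
      (∀ x ∈ ball (0 : EuclideanSpace ℝ (Fin 3)) 1, φ x = 1) ∧
      ∀ t₁ : ℝ, -1 ≤ t₁ → t₁ < 0 →
        ∫ s in (-1 : ℝ)..t₁, ∫ x, frobeniusNormSq (fderiv ℝ (u s) x) * φ x ≤ C := by
  obtain ⟨φ₀, R, B₀, hR1, hB0, hφ₀, hφ₀c, hφ₀nn, hφ₀one, hbd⟩ := exists_cutoff_data
  set C : ℝ := B₀ * (Real.sqrt (2 * a) * (A * (R * (Real.sqrt (2 * a))⁻¹) ^ γ)) +
    2 / (2 - γ) * ((2 * a) ^ (-(γ / 2)) * R ^ γ * B₀ * (ν * Real.sqrt (2 * a) * A + M * A + 2 * J₀)) with hC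
  have hφ : ContDiff ℝ ∞ (fun x : EuclideanSpace ℝ (Fin 3) => φ₀ (x - 0)) :=
    (isTestFunctionOn_comp_sub_right ⟨hφ₀, hφ₀c, by simp⟩ 0).contDiff
  have hφc : HasCompactSupport (fun x : EuclideanSpace ℝ (Fin 3) => φ₀ (x - 0)) :=
    (isTestFunctionOn_comp_sub_right ⟨hφ₀, hφ₀c, by simp⟩ 0).hasCompactSupport
  refine ⟨C / (2 * ν), fun x => φ₀ (x - 0), hφ, hφc, fun x => hφ₀nn _, fun x hx => hφ₀one _ (by simpa using hx),
    fun t₁ ht₁1 ht₁0 => ?_⟩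
  have hE := energy_round hν.le ha hB hu hNS hp hUc hM hγ2 hI hJ (φ := fun x => φ₀ (x - 0)) hφ hφc
    hR1 (fun x => (hbd 0 x).1) (fun x => (hbd 0 x).2.1) (fun x => (hbd 0 x).2.2.1)
    (fun x hx => ((hbd 0 x).2.2.2 hx).1) (fun x hx => ((hbd 0 x).2.2.2 hx).2.1)
    (fun x hx => ((hbd 0 x).2.2.2 hx).2.2) ht₁1 ht₁0
  rw [← hC] at hE
  have h0 : 0 ≤ ∫ x, φ₀ (x - 0) * ‖u t₁ x‖ ^ 2 := integral_nonneg fun x => mul_nonneg (hφ₀nn _) (by positivity)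
  rw [le_div_iff₀ (by positivity)]
  linarith

end Round

end LocalEnergyRescue

end Summit.NavierStokesRegularity.NavierStokesRegularity.Theorems.CoriolisHead

end
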